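import Summits.QuantumFields.YangMills.Theorems.SwapVirialDeficitBlowUpPeriodicTwoScaleDominator
import Summits.QuantumFields.YangMills.Theorems.SwapVirialDeficitZeroModeGroupFourSmallBallTwoScaleLimit
import Summits.QuantumFields.YangMills.Theorems.SwapVirialDeficitTwoScaleSublevelLimit
import HarnessLib

/-!
# The PERIODIC massive-mode rung, brick PM-IId-window: the chart balls of the two-scale fibre FREEZE almost everywhere
# (free-hands support of ⟨stmt-QuantumFields-24196⟩ `SwapVirialDeficit.ToronSoftnessSharp`; hypothesis (hA) of ✓`BlowUp.tendsto_measure_window_inter_sublevel_twoScale`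
# for LEAD ym-line-sfw-p2 g96's ✓`twoScaleFibre` — its window part `dil3P (u²s) (S³_{u,1/u} w′) ∈ ball3 ∧ ∀ f, ‖dilateIm (u²s) y_f‖ < 1`)

In two-scale coordinates the chart balls read `‖(x₀, u·x_I, us·x_J, us·x_K)‖ < 1` per leader letter and `‖(y₀, u²s·Im y)‖ < 1` per follower; as
`(u, s, a) → (0⁺, 0⁺, a₀)` they converge to the slabs `|x₀| < 1`, `|y₀| < 1`, and the equivalence holds EVENTUALLY at every point off the null boundaries
`x₀² = 1` (K4 ✓`volume_re_sq_eq_one_null`).  ★★ `ae_eventually_mem_twoScaleWindow_iff`.  Also `dil3P_sq_mul_scaleQ3` (`dil3P (u²s) ∘ S³_{u,1/u} = S³_{u,us}`),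
`norm_sq_scaleQ`, `eventually_lt_iff_of_tendsto`, `ae_re_sq_ne_one`.
HONEST LABEL: plumbing for a plan-level fixed-`L` rung of a DRAFT line; PM-IIb′/IId assembly (LEAD g96 ∕ successors) NOT proved here; ⟨24196⟩/⟨24497⟩ OPEN; own crux ⟨22884⟩ OPEN
(blocked-on ⟨19935⟩); the Yang–Mills mass gap is NOT proved; no summit is proved by a line.  Width seat ym-line-sfw-p2-w3 g64 (cell ym-idea-1, free hands),
`--supports stmt-QuantumFields-24196`.  THEOREMS ONLY (0 `def`, 0 `sorry`), standard axioms.  References: [cite: Luscher1983, §2]; [folklore].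
-/

set_option autoImplicit false

noncomputable section

open MeasureTheory Quaternion Set Filter Topology
open scoped Quaternion ENNReal
open Literature.MathematicalPhysics.QuantumLattice
open Literature.MathematicalPhysics.QuantumFieldTheory hiding SU2
open Summit.QuantumFields.YangMills.Theorems.SwapTwistDeficit.ToronLog

attribute [local instance] Literature.Analysis.FluidPDE.Tao2016.quatMeasurableSpace
  Literature.Analysis.FluidPDE.Tao2016.quatBorelSpace
  Literature.MathematicalPhysics.QuantumLattice.secondCountableTopology_su2

namespace Summit.QuantumFields.YangMills.Theorems.SwapVirialDeficit.BlowUpRing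

open Summit.QuantumFields.YangMills.Theorems.FemtoTransferGap
open Summit.QuantumFields.YangMills.Theorems.FemtoTransferGap.TT
open Summit.QuantumFields.YangMills.Theorems.SwapVirialDeficit.ZeroModeSigma (ball3 mem_ball3_iff dilateIm norm_sq_dilateIm)
open Summit.QuantumFields.YangMills.Theorems.SwapVirialDeficit.ZeroModeGroup
open Summit.QuantumFields.YangMills.Theorems.SwapVirialDeficit.BlowUp (dil3P tendsto_twoScale_of_continuousAt)

variable {L : ℕ} [NeZero L]

/-! ## §1 The window in two-scale coordinates -/

omit [NeZero L] in
/-- `dil3P (u²s) (S³_{u,1/u} w) = S³_{u, us} w` (`u ≠ 0`). [folklore] -/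
theorem dil3P_sq_mul_scaleQ3 {u : ℝ} (hu : u ≠ 0) (s : ℝ) (w : (ℍ × ℍ) × ℍ) :
    dil3P (u ^ 2 * s) (scaleQ3 u u⁻¹ w) = scaleQ3 u (u * s) w := by
  rw [dil3P_eq_scaleQ3, ← scaleQ3_comp, one_mul]
  congr 1
  field_simp

omit [NeZero L] in
/-- `‖S_{m,l} x‖² = x₀² + m²x_I² + l²(x_J² + x_K²)`. [folklore] -/
theorem norm_sq_scaleQ (m l : ℝ) (x : ℍ) : ‖scaleQ m l x‖ ^ 2 = x.re ^ 2 + m ^ 2 * x.imI ^ 2 + l ^ 2 * (x.imJ ^ 2 + x.imK ^ 2) := by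
  rw [sq_norm_eq_sum_sq, scaleQ_re, scaleQ_imI, scaleQ_imJ, scaleQ_imK]; ring

omit [NeZero L] in
/-- Off the level `c`, a convergent net decides `< c` eventually as its limit does. [folklore] -/
theorem eventually_lt_iff_of_tendsto {ι : Type*} {l : Filter ι} {f : ι → ℝ} {a c : ℝ} (h : Tendsto f l (𝓝 a)) (ha : a ≠ c) :
    ∀ᶠ i in l, f i < c ↔ a < c := by
  rcases lt_or_gt_of_ne ha with hlt | hgt
  · filter_upwards [h.eventually (gt_mem_nhds hlt)] with i hi
    exact ⟨fun _ => hlt, fun _ => hi⟩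
  · filter_upwards [h.eventually (lt_mem_nhds hgt)] with i hi
    exact ⟨fun h' => absurd h' (not_lt.2 hi.le), fun h' => absurd h' (not_lt.2 hgt.le)⟩

omit [NeZero L] in
/-- One leader letter: `‖S_{u,us} x‖ < 1 ↔ |x₀| < 1` eventually along the two-scale filter, when `x₀² ≠ 1`. [folklore] -/
theorem eventually_norm_scaleQ_lt_iff {x : ℍ} (hx : x.re ^ 2 ≠ 1) (a₀ : ℝ) :
    ∀ᶠ q : (ℝ × ℝ) × ℝ in (𝓝[>] (0 : ℝ) ×ˢ 𝓝[>] (0 : ℝ)) ×ˢ 𝓝 a₀, ‖scaleQ q.1.1 (q.1.1 * q.1.2) x‖ < 1 ↔ |x.re| < 1 := by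
  have hF : ContinuousAt (fun p : ℝ × ℝ × ℝ => x.re ^ 2 + p.1 ^ 2 * x.imI ^ 2 + (p.1 * p.2.1) ^ 2 * (x.imJ ^ 2 + x.imK ^ 2)) (0, 0, a₀) := by
    fun_prop
  have ht := tendsto_twoScale_of_continuousAt hF
  simp only [zero_pow two_ne_zero, zero_mul, mul_zero, add_zero] at ht
  filter_upwards [eventually_lt_iff_of_tendsto ht hx] with q hq
  rw [← sq_lt_one_iff₀ (norm_nonneg _), norm_sq_scaleQ, hq, sq_lt_one_iff_abs_lt_one]

omit [NeZero L] in
/-- One follower: `‖dilateIm (u²s) y‖ < 1 ↔ |y₀| < 1` eventually along the two-scale filter, when `y₀² ≠ 1`. [folklore] -/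
theorem eventually_norm_dilateIm_lt_iff {y : ℍ} (hy : y.re ^ 2 ≠ 1) (a₀ : ℝ) :
    ∀ᶠ q : (ℝ × ℝ) × ℝ in (𝓝[>] (0 : ℝ) ×ˢ 𝓝[>] (0 : ℝ)) ×ˢ 𝓝 a₀, ‖dilateIm (q.1.1 ^ 2 * q.1.2) y‖ < 1 ↔ |y.re| < 1 := by
  have hF : ContinuousAt (fun p : ℝ × ℝ × ℝ => y.re ^ 2 + (p.1 ^ 2 * p.2.1) ^ 2 * (y.imI ^ 2 + y.imJ ^ 2 + y.imK ^ 2)) (0, 0, a₀) := by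
    fun_prop
  have ht := tendsto_twoScale_of_continuousAt hF
  simp only [zero_pow two_ne_zero, zero_mul, mul_zero, add_zero] at ht
  filter_upwards [eventually_lt_iff_of_tendsto ht hy] with q hq
  rw [← sq_lt_one_iff₀ (norm_nonneg _), norm_sq_dilateIm, hq, sq_lt_one_iff_abs_lt_one]

/-! ## §2 Almost every point is off the boundaries -/

/-- A.e. in `vol³ ⊗ vol^{Fol}`: no leader letter and no follower has `x₀² = 1`. [folklore] -/
theorem ae_re_sq_ne_one :
    ∀ᵐ ξ : ((ℍ × ℍ) × ℍ) × (Fol L → ℍ) ∂((volume : Measure ((ℍ × ℍ) × ℍ)).prod (Measure.pi fun _ : Fol L => (volume : Measure ℍ))),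
      (ξ.1.1.1.re ^ 2 ≠ 1 ∧ ξ.1.1.2.re ^ 2 ≠ 1 ∧ ξ.1.2.re ^ 2 ≠ 1) ∧ ∀ i, (ξ.2 i).re ^ 2 ≠ 1 := by
  have hv : ∀ᵐ v : ℍ ∂(volume : Measure ℍ), v.re ^ 2 ≠ 1 := by
    rw [ae_iff]; simpa only [ne_eq, not_not] using volume_re_sq_eq_one_null
  have h3 : ∀ᵐ w : (ℍ × ℍ) × ℍ ∂(volume : Measure ((ℍ × ℍ) × ℍ)), w.1.1.re ^ 2 ≠ 1 ∧ w.1.2.re ^ 2 ≠ 1 ∧ w.2.re ^ 2 ≠ 1 := by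
    have hx : ∀ᵐ w : (ℍ × ℍ) × ℍ ∂volume, w.1.1.re ^ 2 ≠ 1 := (Measure.quasiMeasurePreserving_fst.comp Measure.quasiMeasurePreserving_fst).ae hv
    have hy : ∀ᵐ w : (ℍ × ℍ) × ℍ ∂volume, w.1.2.re ^ 2 ≠ 1 := (Measure.quasiMeasurePreserving_snd.comp Measure.quasiMeasurePreserving_fst).ae hv
    have hz : ∀ᵐ w : (ℍ × ℍ) × ℍ ∂volume, w.2.re ^ 2 ≠ 1 := Measure.quasiMeasurePreserving_snd.ae hv
    filter_upwards [hx, hy, hz] with w a b c using ⟨a, b, c⟩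
  have hF : ∀ᵐ y : Fol L → ℍ ∂(Measure.pi fun _ : Fol L => (volume : Measure ℍ)), ∀ i, (y i).re ^ 2 ≠ 1 := by
    rw [ae_all_iff]
    intro i
    have h0 : (Measure.pi fun _ : Fol L => (volume : Measure ℍ)) (Function.eval i ⁻¹' {v : ℍ | v.re ^ 2 = 1}) = 0 :=
      Measure.pi_eval_preimage_null _ volume_re_sq_eq_one_null
    rw [ae_iff]
    refine measure_mono_null (fun y hy => ?_) h0
    simpa only [Set.mem_setOf_eq, not_not, Set.mem_preimage] using hy
  filter_upwards [(Measure.quasiMeasurePreserving_fst (μ := (volume : Measure ((ℍ × ℍ) × ℍ)))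
      (ν := Measure.pi fun _ : Fol L => (volume : Measure ℍ))).ae h3,
    (Measure.quasiMeasurePreserving_snd (μ := (volume : Measure ((ℍ × ℍ) × ℍ)))
      (ν := Measure.pi fun _ : Fol L => (volume : Measure ℍ))).ae hF] with ξ h1 h2 using ⟨h1, h2⟩

/-! ## §3 The freezing -/

/-- ★★ **THE CHART BALLS FREEZE A.E.**  For a.e. `ξ = (w′, y)`, eventually along `(𝓝[>]0 ×ˢ 𝓝[>]0) ×ˢ 𝓝 a₀`:
`(dil3P (u²s) (S³_{u,1/u} w′) ∈ ball3 ∧ ∀ f, ‖dilateIm (u²s) y_f‖ < 1) ↔ ((|x₀| < 1 ∧ |y′₀| < 1) ∧ |z₀| < 1) ∧ ∀ f, |re y_f| < 1`. [folklore] -/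
theorem ae_eventually_mem_twoScaleWindow_iff (a₀ : ℝ) :
    ∀ᵐ ξ : ((ℍ × ℍ) × ℍ) × (Fol L → ℍ) ∂((volume : Measure ((ℍ × ℍ) × ℍ)).prod (Measure.pi fun _ : Fol L => (volume : Measure ℍ))),
      ∀ᶠ q : (ℝ × ℝ) × ℝ in (𝓝[>] (0 : ℝ) ×ˢ 𝓝[>] (0 : ℝ)) ×ˢ 𝓝 a₀,
        (dil3P (q.1.1 ^ 2 * q.1.2) (scaleQ3 q.1.1 q.1.1⁻¹ ξ.1) ∈ ball3 ∧ ∀ i, ‖dilateIm (q.1.1 ^ 2 * q.1.2) (ξ.2 i)‖ < 1) ↔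
          (((|ξ.1.1.1.re| < 1 ∧ |ξ.1.1.2.re| < 1) ∧ |ξ.1.2.re| < 1) ∧ ∀ i, |(ξ.2 i).re| < 1) := by
  filter_upwards [ae_re_sq_ne_one (L := L)] with ξ hξ
  obtain ⟨⟨hx, hy, hz⟩, hfol⟩ := hξ
  have hu : ∀ᶠ q : (ℝ × ℝ) × ℝ in (𝓝[>] (0 : ℝ) ×ˢ 𝓝[>] (0 : ℝ)) ×ˢ 𝓝 a₀, 0 < q.1.1 :=
    (tendsto_fst.comp tendsto_fst).eventually self_mem_nhdsWithin
  have hfol' : ∀ᶠ q : (ℝ × ℝ) × ℝ in (𝓝[>] (0 : ℝ) ×ˢ 𝓝[>] (0 : ℝ)) ×ˢ 𝓝 a₀, ∀ i, ‖dilateIm (q.1.1 ^ 2 * q.1.2) (ξ.2 i)‖ < 1 ↔ |(ξ.2 i).re| < 1 :=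
    eventually_all.2 fun i => eventually_norm_dilateIm_lt_iff (hfol i) a₀
  filter_upwards [hu, eventually_norm_scaleQ_lt_iff hx a₀, eventually_norm_scaleQ_lt_iff hy a₀, eventually_norm_scaleQ_lt_iff hz a₀, hfol']
    with q hq ex ey ez ef
  rw [dil3P_sq_mul_scaleQ3 hq.ne', mem_ball3_iff, scaleQ3_apply]
  simp only
  rw [ex, ey, ez, forall_congr' ef]

end Summit.QuantumFields.YangMills.Theorems.SwapVirialDeficit.BlowUpRing

end
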